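import Mathlib
import Summits.Ventures.PercRepro2.LocRows
import Summits.Ventures.PercRepro2.SwRow
import Summits.Ventures.PercRepro2.SwOut

/-!
# The master conditioning (M) — the statement of record above (SW), the typed row and (HLC)
(blind cell PercRepro2, night-4 g9, 2026-08-25; proofs/NIGHT4-G9.md §6)

Statement (M): for every up-set `𝓦` of PAIRS of vertex sets in the order «first coordinate grows,
second shrinks», every region `U ∋ h` with `l ∉ U` and every outside colouring `ξ`, the class
`{ζ ∈ outClass U h ξ ∣ h ∉ H_l, (C_R(l), C_B(l)) ∈ 𝓦}` has an injection into itself carrying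
`C_R(h)` into `C_B(h)` of the image.  `Q = {h ∉ H_l, o ∈ R_side(l)}` is the case
`𝓦 = {(A, B) ∣ o ∈ A ∧ o ∉ B}`, so (M) gives (HLC) (`swOut_of_swMaster`) and row (SW)
(`sw_of_swMaster`); the non-rigid typed row of g6 is the case `𝓦 = 𝓤 × 𝓓`, (DOM2)'s rectangle form
the case `𝓦 = 𝓤 × univ`.  Census (own code, random generators): 0 failures on all connected graphs
with n ≤ 6 and on all 350 seven-vertex graphs with m ≤ 9 (473,180 classes).  A CONJECTURE typed, not
a theorem; its star classes are theorems (`SwOutStarThm.swOut_star_pair`).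

* `IsPairUpSet`, `pairClass`, **`SwMaster`**, `SwMaster_all`;
* `isPairUpSet_side` — `{(A, B) ∣ o ∈ A ∧ o ∉ B}` is an up-set of pairs; `pairClass_side_eq` — its class
  is `swOutSide`;
* `swOut_of_swMaster`, `sw_of_swMaster`, `swOut_all_of_swMaster_all`, `sw_all_of_swMaster_all`.
-/

namespace Summit.Ventures.PercRepro2

namespace LocRows

open Hull

variable {V : Type*} {E : Type*} [Fintype E] [DecidableEq E]

open scoped Classical

variable (ends : E → Sym2 V)

/-- An up-set of pairs of vertex sets in the order «first coordinate grows, second shrinks». -/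
def IsPairUpSet (𝓦 : Set (Set V × Set V)) : Prop :=
  ∀ A A' B B' : Set V, A ⊆ A' → B' ⊆ B → (A, B) ∈ 𝓦 → (A', B') ∈ 𝓦

/-- The class of the master form: the outside class with `h ∉ H_l` and `(C_R(l), C_B(l)) ∈ 𝓦`. -/
noncomputable def pairClass (l h : V) (𝓦 : Set (Set V × Set V)) (U : Set V) (ξ : Config E) :
    Finset (Config E) :=
  (outClass ends U h ξ).filter fun ζ =>
    h ∉ hull ends ζ l ∧ (cluster ends ζ l, cluster ends (blue ζ) l) ∈ 𝓦

/-- **Statement (M), the master conditioning**: for every up-set of pairs `𝓦`, every region `U ∋ h`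
with `l ∉ U` and every `ξ`, an injection of `pairClass l h 𝓦 U ξ` into itself carrying the red
cluster of `h` into the blue cluster of `h` of the image. -/
def SwMaster (l h : V) : Prop :=
  ∀ (𝓦 : Set (Set V × Set V)) (U : Set V) (ξ : Config E), IsPairUpSet 𝓦 → h ∈ U → l ∉ U →
    ∃ f : {ζ // ζ ∈ pairClass ends l h 𝓦 U ξ} → Config E, Function.Injective f ∧
      ∀ x, f x ∈ pairClass ends l h 𝓦 U ξ ∧ cluster ends x.1 h ⊆ cluster ends (blue (f x)) h

variable {ends}

/-- Membership in the class of the master form. -/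
lemma mem_pairClass {l h : V} {𝓦 : Set (Set V × Set V)} {U : Set V} {ξ ζ : Config E} :
    ζ ∈ pairClass ends l h 𝓦 U ξ ↔ ζ ∈ outClass ends U h ξ ∧ h ∉ hull ends ζ l ∧
      (cluster ends ζ l, cluster ends (blue ζ) l) ∈ 𝓦 := by
  simp only [pairClass, Finset.mem_filter]

omit [Fintype E] [DecidableEq E] in
/-- The side event `{(A, B) ∣ o ∈ A ∧ o ∉ B}` is an up-set of pairs. -/
lemma isPairUpSet_side (o : V) : IsPairUpSet {p : Set V × Set V | o ∈ p.1 ∧ o ∉ p.2} := by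
  rintro A A' B B' hA hB ⟨hoA, hoB⟩
  exact ⟨hA hoA, fun h' => hoB (hB h')⟩

/-- The class of the side event is `swOutSide`. -/
lemma pairClass_side_eq (l h o : V) (U : Set V) (ξ : Config E) :
    pairClass ends l h {p : Set V × Set V | o ∈ p.1 ∧ o ∉ p.2} U ξ = swOutSide ends l h o U ξ := by
  ext ζ
  rw [mem_pairClass, mem_swOutSide]
  simp only [tgtU, Finset.mem_filter, Finset.mem_univ, true_and, Set.mem_setOf_eq]
  tauto

/-- **(M) gives (HLC)**. -/
theorem swOut_of_swMaster {l h o : V} (hm : SwMaster ends l h) : SwOut ends l h o := by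
  intro U ξ hU hl
  have := hm {p : Set V × Set V | o ∈ p.1 ∧ o ∉ p.2} U ξ (isPairUpSet_side o) hU hl
  rw [pairClass_side_eq] at this
  exact this

/-- **(M) gives row (SW)**. -/
theorem sw_of_swMaster {l h o : V} (hlh : l ≠ h) (hm : SwMaster ends l h) : Sw ends l h o :=
  sw_of_swOut l h o hlh (swOut_of_swMaster hm)

variable (ends)

/-- Statement (M) over all finite graphs and markings. -/
def SwMaster_all : Prop :=
  ∀ (V E : Type) [Fintype V] [DecidableEq V] [Fintype E] [DecidableEq E] (ends : E → Sym2 V)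
    (l h : V), l ≠ h → SwMaster ends l h

/-- `SwMaster_all` gives `SwOut_all`. -/
theorem swOut_all_of_swMaster_all (hm : SwMaster_all) : SwOut_all := by
  intro V E _ _ _ _ ends l h o hlh _ _
  exact swOut_of_swMaster (hm V E ends l h hlh)

/-- `SwMaster_all` gives `Sw_all`. -/
theorem sw_all_of_swMaster_all (hm : SwMaster_all) : Sw_all :=
  sw_all_of_swOut_all (swOut_all_of_swMaster_all hm)

end LocRows

end Summit.Ventures.PercRepro2
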